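import Summits.BirchSwinnertonDyer.BirchSwinnertonDyer.Theorems.ThetaPartnerAtTwoSignedKatoUpToAtTwoLayerPairingPk
import Literature.NumberTheory.GaloisRepresentations.ContinuousShapiroLiftFunctor
import Literature.NumberTheory.EllipticCurves.WeilPairingLevelCompatProofs
import Literature.AnabelianGeometry.AbsoluteAnabelian.GaloisCyclotomeH2Levels
import Literature.NumberTheory.GaloisRepresentations.BrauerTower
import HarnessLib

/-!
# Route `ThetaPartnerAtTwo` (TP2), crux K3 `SignedKatoDivisibilityUpToAtTwo` (item stmt-BirchSwinnertonDyer-20308),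
# line `colemanrat` v7 — (D-layer), UNCONDITIONAL: the level compatibility `ℤ/p^{k+1} → ℤ/p^k` of the finite local Tate
# pairings and the `ℤ_p`-linear layer pairings `pair n : H¹(ℚ_n, T_pW) →ₗ[ℤ_p] Hom(E(ℚ_{n,v}), ℤ_p)` with (P1), (P2)

Width seat `bsd-wall-tp2-p2x-w3` g4 (cell `bsd-wall`). Definitions with bodies (`torsionPow`, `torsionLocalPow`, `muLocalPow`,
`weilTowerPk`) and theorems; no named fact, no instance, no `sorry`; closes no item; BSD is NOT proved by any of this.

## What is here

On top of `…LayerPairingPk.lean` (`layerPairingPk … n k = inv_v(Sh loc red_k · ∪_{e_{p^k}} Sh κ_k ·)`, (P1_k)/(P2_k),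
`exists_linear_layerPairing_of_compatible`):

* §4 the LEVEL COMPATIBILITY **`layerPairingPk_succ_compat`**: `pk n (k+1) x Q mod p^k = pk n k x Q`, from six commuting
  squares — (1) `[p]_* ∘ red_{p^{k+1}} = red_{p^k}` (`TateModule.smul_proj_succ`), (2)/(3) naturality of `loc_n` and of the
  Shapiro isomorphism in the coefficients (`shapiroLift_cohomologyMap`, `ContinuousShapiroLiftFunctor`), (4) `[p]_* κ_{p^{k+1}} Q
  = κ_{p^k} Q` (same root `R`, `p^k • (p • R) = Q`), (5) the cup products along the morphism of pairings
  `e_{p^k}(pS, pT) = e_{p^{k+1}}(S,T)^p` (`ContPairing.cupProduct_coindFin_map`), (6) THE invariant maps along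
  `(·)^p : μ_{p^{k+1}} → μ_{p^k}` (`invLevel_muPowHom` transported along `muLocalIso`);
* §5 **`exists_linear_layerPairing`** (unconditional): for the cyclotomic tower at `v ∣ p`, `∃ pair : ∀ n, H¹(Γ_n, T_pW)
  →ₗ[ℤ_p] (E(ℚ_{n,v}) →+ ℤ_p)` whose residues mod `p^k` are THE pairings `layerPairingPk` for THE Weil pairings of the tree
  (`weilTowerPk k = WeierstrassCurve.weilPairingFun` at level `p^k`, compatible by `weilPairingFun_pow_succ` = Silverman
  III.8.1 (e)), with (P1) `pair n (layerCores x) Q = pair (n+1) x Q` and (P2) `pair n (g̃ · y) (g • Q) = pair n y Q` for every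
  `g ∈ Γ_v` — the (pair, P1, P2) data of `Cruxes.SignedKatoDivisibilityUpToAtTwo.ColemanRat.stub_layerSideTwoInv`, in
  EXACTLY the form of the hypotheses of `SignedKatoOffTwo.ColGlue.exists_col_linear` (w2).

What this does NOT do: (PT-orth) (`pair n (loc c_n^±) = 0` on `E^∓_n` — lead lane; value formula `layerPairingMod_apply`),
(GEN)/(ES)/(ERL♭) (Kato 12.5 + Otsuki 2009 at `p = 2` — PUB), hence not `stub_layerSideTwoInv`, not K3, not BSD.

References: [Kobayashi2003] (8.23); [PerrinRiou1994Invent] §3.6.1; [Kato2004Asterisque] §13.8; [SilvermanAEC2009] III.8.1; [SerreLocalFields1979] XIII §3.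
-/

set_option autoImplicit false
-- the Theorems namespace of this sub repeats the summit name by design (D-0017 nested layout)
set_option linter.dupNamespace false

noncomputable section

open scoped Classical

namespace Summit.BirchSwinnertonDyer.BirchSwinnertonDyer.Theorems

namespace SignedKatoOffTwo.LayerPairing

open CategoryTheory Field NumberField IsDedekindDomain WeierstrassCurve
  Literature.NumberTheory.EllipticCurves Literature.NumberTheory.GaloisRepresentations
  Literature.NumberTheory.EllipticCurves.Kobayashi2003 Literature.NumberTheory.EllipticCurves.Sprung2012
  Literature.NumberTheory.GaloisCohomology ZpExtension

attribute [local instance] absoluteGaloisGroup_compactSpace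

variable (W : WeierstrassCurve ℚ) [W.IsElliptic] {p : ℕ} [Fact p.Prime] (κ : ZpExtension ℚ p) (v : HeightOneSpectrum (𝓞 ℚ))

attribute [local instance] finite_geomTorsion_of_neZero





/-! ## §4 Level compatibility `ℤ/p^{k+1} → ℤ/p^k` of the layer pairings, and the unconditional `∃ pair` -/

section Compat

open Literature.NumberTheory.EllipticCurves.Kato2004 Literature.NumberTheory.EllipticCurves.Kato2004.EulerSystemValues
  Literature.AnabelianGeometry.AbsoluteAnabelian

variable (k : ℕ)

omit [Fact p.Prime] in
/-- `p^k * p = p^(k+1)`. [cite: SilvermanAEC2009, Prop. III.8.1(e)] -/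
theorem pow_mul_prime_eq : p ^ k * p = p ^ (k + 1) := (pow_succ p k).symm

omit [W.IsElliptic] [Fact p.Prime] in
/-- `[p] : E[p^{k+1}] → E[p^k]` lands in `E[p^k]`. [cite: SilvermanAEC2009, Prop. III.8.1(e)] -/
theorem zsmul_mem_geomTorsion_pow (P : geomTorsion W ((p ^ (k + 1) : ℕ) : ℤ)) :
    (p : ℤ) • (P : geomPoints W) ∈ geomTorsion W ((p ^ k : ℕ) : ℤ) := by
  rw [mem_geomTorsion_iff, smul_smul]
  have h : (((p ^ k : ℕ) : ℤ) * (p : ℤ)) = ((p ^ (k + 1) : ℕ) : ℤ) := by push_cast; ring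
  rw [h]
  exact (mem_geomTorsion_iff W _ _).mp P.2

/-- **`[p] : E[p^{k+1}] ⟶ E[p^k]`** as a morphism of the discrete `Γ_ℚ`-modules (the transition map of `T_pE` read on the
torsion levels with the `ℕ`-cast index). [cite: SilvermanAEC2009, Prop. III.8.1(e)] [cite: Kato2004Asterisque, §13.8 (p. 228)] -/
def torsionPow : (W.torsionGaloisModule ((p ^ (k + 1) : ℕ) : ℤ)).toTopRep ⟶ (W.torsionGaloisModule ((p ^ k : ℕ) : ℤ)).toTopRep :=
  TopRep.ofHom
    { toContinuousLinearMap :=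
        { toFun := fun P => ⟨(p : ℤ) • (P : geomPoints W), zsmul_mem_geomTorsion_pow W k P⟩
          map_add' := fun P Q => Subtype.ext (by
            change (p : ℤ) • ((P : geomPoints W) + Q) = (p : ℤ) • (P : geomPoints W) + (p : ℤ) • (Q : geomPoints W)
            rw [zsmul_add])
          map_smul' := fun c P => Subtype.ext (by
            change (p : ℤ) • (c • (P : geomPoints W)) = c • ((p : ℤ) • (P : geomPoints W))
            rw [smul_comm])
          cont := continuous_of_discreteTopology }
      isIntertwining' := fun σ => by
        ext P
        change (p : ℤ) • ((σ • P : geomTorsion W ((p ^ (k + 1) : ℕ) : ℤ)) : geomPoints W) = σ • ((p : ℤ) • (P : geomPoints W))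
        rw [Literature.NumberTheory.EllipticCurves.AddSubgroup.torsionBy.coe_smul, smul_zsmul_geomPoints] }

omit [W.IsElliptic] [Fact p.Prime] in
/-- Values of `torsionPow` on underlying points: `P ↦ p • P`. [cite: SilvermanAEC2009, Prop. III.8.1(e)] -/
@[simp] theorem coe_torsionPow_apply (P : geomTorsion W ((p ^ (k + 1) : ℕ) : ℤ)) :
    (((torsionPow W k).hom P : geomTorsion W ((p ^ k : ℕ) : ℤ)) : geomPoints W) = (p : ℤ) • (P : geomPoints W) := rfl

/-- **`[p]` on the local coefficient modules** `E[p^{k+1}]|_{Γ_v} ⟶ E[p^k]|_{Γ_v}`. [cite: SilvermanAEC2009, Prop. III.8.1(e)] -/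
def torsionLocalPow : torsionLocalRep W (p ^ (k + 1)) v ⟶ torsionLocalRep W (p ^ k) v :=
  TopRep.ofHom ((torsionPow W k).hom.restrictField (v.adicCompletion ℚ))

omit [W.IsElliptic] [Fact p.Prime] in
/-- Values of `torsionLocalPow`. [cite: SilvermanAEC2009, Prop. III.8.1(e)] -/
@[simp] theorem coe_torsionLocalPow_apply (P : geomTorsion W ((p ^ (k + 1) : ℕ) : ℤ)) :
    (((torsionLocalPow W v k).hom P : geomTorsion W ((p ^ k : ℕ) : ℤ)) : geomPoints W) = (p : ℤ) • (P : geomPoints W) := rfl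

/-- **`(·)^p : μ_{p^{k+1}}|_{Γ_v} ⟶ μ_{p^k}|_{Γ_v}`** (the tree's `muPowHom` restricted to `Γ_v`). [cite: SerreLocalFields1979, XIII §3] -/
def muLocalPow : muLocalRep (p ^ (k + 1)) v ⟶ muLocalRep (p ^ k) v :=
  TopRep.ofHom ((muPowHom ℚ (p ^ (k + 1)) (p ^ k) p (pow_mul_prime_eq k)).hom.restrictField (v.adicCompletion ℚ))

omit [Fact p.Prime] in
/-- Values of `muLocalPow`: `ζ ↦ ζ^p` on underlying units. [cite: SerreLocalFields1979, XIII §3] -/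
@[simp] theorem muVal_muLocalPow (x : DiscreteGaloisModule.MuCarrier ℚ (p ^ (k + 1))) :
    muVal ℚ (p ^ k) ((muLocalPow v k).hom x) = muVal ℚ (p ^ (k + 1)) x ^ p := rfl

variable [ContinuousSMul ℤ_[p] (W.tateModule p)]

/-- **(1) The reductions are compatible**: `[p]_* ∘ red_{p^{k+1}} = red_{p^k}` on `H¹(U, ·)` (`p • a_{k+1} = a_k` on `T_pW`,
`TateModule.smul_proj_succ`). [cite: Kato2004Asterisque, §13.8 (p. 228)] [cite: PerrinRiou1987BSMF, §0] -/
theorem cohomologyMap_torsionPow_reduceH1Pk (U : Subgroup (absoluteGaloisGroup ℚ)) (x : H1 (tateRep W p) U) :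
    cohomologyMap (subgroupRepMap (torsionPow W k) U) 1 (reduceH1Pk W p (k + 1) U x) = reduceH1Pk W p k U x := by
  obtain ⟨φ, rfl⟩ := oneCocycleClass_surjective _ x
  rw [reduceH1Pk_oneCocycleClass, reduceH1Pk_oneCocycleClass]
  erw [cohomologyMap_oneCocycleClass] -- index `(p : ℤ)^(k+1)` of `reduceH1Pk` is defeq to the `ℕ`-cast index
  congr 1
  apply Subtype.ext
  ext g
  rw [pullback_id_resIdHom_apply]
  change (p : ℤ) • TateModule.proj p (k + 1) (φ.1 g) = TateModule.proj p k (φ.1 g)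
  rw [natCast_zsmul]
  exact TateModule.smul_proj_succ k (φ.1 g)

omit [ContinuousSMul ℤ_[p] (W.tateModule p)] [W.IsElliptic] in
/-- **(2) Localisation is natural in the coefficients**: `loc ∘ [p]_* = [p]_* ∘ loc`. [cite: Kobayashi2003, (8.23) (p. 18)] -/
theorem layerLoc_cohomologyMap_torsionPow (n : ℕ) (y : H1 (W.torsionGaloisModule ((p ^ (k + 1) : ℕ) : ℤ)) (κ.layerSubgroup n)) :
    layerLoc W (p ^ k) κ v n (cohomologyMap (subgroupRepMap (torsionPow W k) (κ.layerSubgroup n)) 1 y) =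
      cohomologyMap (subgroupRepMap (torsionLocalPow W v k) (layerGroup κ v n)) 1 (layerLoc W (p ^ (k + 1)) κ v n y) := by
  obtain ⟨φ, rfl⟩ := oneCocycleClass_surjective _ y
  unfold layerLoc
  rw [cohomologyMap_oneCocycleClass, map_oneCocycleClass, map_oneCocycleClass, cohomologyMap_oneCocycleClass]
  congr 1

omit [ContinuousSMul ℤ_[p] (W.tateModule p)] in
/-- **(4) The layer Kummer maps are compatible**: `[p]_* κ_{U_n,p^{k+1}}(Q) = κ_{U_n,p^k}(Q)` (a root `R'` at level `p^{k+1}` gives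
the root `p R'` at level `p^k`; `p(τR' − R') = τ(pR') − pR'`). [cite: SilvermanAEC2009, VIII §2] [cite: MilneADT2006, Ch. I §6, proof of Prop. 6.9] -/
theorem cohomologyMap_torsionLocalPow_layerKummer (n : ℕ)
    (Q : localLayerPointsOfEmb κ (closureEmb (K := ℚ) (v.adicCompletion ℚ)) W n) :
    cohomologyMap (subgroupRepMap (torsionLocalPow W v k) (layerGroup κ v n)) 1 (layerKummer W (p ^ (k + 1)) κ v n Q) =
      layerKummer W (p ^ k) κ v n Q := by
  have hN' : ((p ^ (k + 1) : ℕ) : ℤ) ≠ 0 := by exact_mod_cast pow_ne_zero (k + 1) (Fact.out : p.Prime).ne_zero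
  have hN : ((p ^ k : ℕ) : ℤ) ≠ 0 := by exact_mod_cast pow_ne_zero k (Fact.out : p.Prime).ne_zero
  set R' := W.subgroupZSMulRoot ((p ^ (k + 1) : ℕ) : ℤ) hN' (Q : localPoints W (v.adicCompletion ℚ)) with hR'
  have hroot' : ((p ^ (k + 1) : ℕ) : ℤ) • R' = Q := W.zsmul_subgroupZSMulRoot _ hN' _
  have hroot : ((p ^ k : ℕ) : ℤ) • ((p : ℤ) • R') = Q := by
    rw [smul_smul]
    have h : (((p ^ k : ℕ) : ℤ) * (p : ℤ)) = ((p ^ (k + 1) : ℕ) : ℤ) := by push_cast; ring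
    rw [h, hroot']
  have hfix' : ((p ^ (k + 1) : ℕ) : ℤ) • R' ∈ FixedPoints.addSubgroup (layerGroup κ v n) (localPoints W (v.adicCompletion ℚ)) := by
    rw [hroot']; exact Q.2
  have hfix : ((p ^ k : ℕ) : ℤ) • ((p : ℤ) • R') ∈ FixedPoints.addSubgroup (layerGroup κ v n) (localPoints W (v.adicCompletion ℚ)) := by
    rw [hroot]; exact Q.2
  change cohomologyMap (subgroupRepMap (torsionLocalPow W v k) (layerGroup κ v n)) 1
      (W.subgroupKummerMap ((p ^ (k + 1) : ℕ) : ℤ) (layerGroup κ v n) hN' Q) =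
    W.subgroupKummerMap ((p ^ k : ℕ) : ℤ) (layerGroup κ v n) hN Q
  rw [W.subgroupKummerMap_apply_eq _ (layerGroup κ v n) hN' Q R' hfix' hroot',
    W.subgroupKummerMap_apply_eq _ (layerGroup κ v n) hN Q ((p : ℤ) • R') hfix hroot]
  unfold WeierstrassCurve.subgroupKummerClass
  rw [cohomologyMap_oneCocycleClass]
  congr 1
  apply Subtype.ext
  ext τ
  apply pointsMapOfEmb_injective W (closureEmb (K := ℚ) (v.adicCompletion ℚ))
  rw [pullback_id_resIdHom_apply, subgroupRepMap_apply]
  change pointsMap W (v.adicCompletion ℚ) ((((torsionLocalPow W v k).hom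
      ((W.subgroupKummerCocycle ((p ^ (k + 1) : ℕ) : ℤ) (layerGroup κ v n) hN' R' hfix').1 τ)) : geomTorsion W _) : geomPoints W) =
    pointsMap W (v.adicCompletion ℚ) (((W.subgroupKummerCocycle ((p ^ k : ℕ) : ℤ) (layerGroup κ v n) hN ((p : ℤ) • R') hfix).1 τ :
      geomTorsion W _) : geomPoints W)
  rw [coe_torsionLocalPow_apply, map_zsmul, WeierstrassCurve.pointsMap_subgroupKummerCocycle_apply,
    WeierstrassCurve.pointsMap_subgroupKummerCocycle_apply, zsmul_sub, WeierstrassCurve.smul_zsmul_localPoints]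

variable (ePk : ∀ k : ℕ, geomTorsion W (p ^ k) → geomTorsion W (p ^ k) → AlgebraicClosure ℚ)
  (hμPk : ∀ k S T, ePk k S T ^ (p ^ k) = 1)
  (hadd₁Pk : ∀ k S₁ S₂ T, ePk k (S₁ + S₂) T = ePk k S₁ T * ePk k S₂ T)
  (hadd₂Pk : ∀ k S T₁ T₂, ePk k S (T₁ + T₂) = ePk k S T₁ * ePk k S T₂)
  (hgalPk : ∀ k (σ : absoluteGaloisGroup ℚ) (S T : geomTorsion W (p ^ k)), σ • ePk k S T = ePk k (σ • S) (σ • T))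
  (hcompatPk : ∀ k (S T : geomTorsion W ((p ^ (k + 1) : ℕ) : ℤ)),
    ePk k ((torsionPow W k).hom S) ((torsionPow W k).hom T) = ePk (k + 1) S T ^ p)

include hcompatPk in
omit [ContinuousSMul ℤ_[p] (W.tateModule p)] [W.IsElliptic] in
/-- The module identity behind (5): `(e_{k+1}(S,T))^p = e_k(pS, pT)` read on the carriers `μ`. [cite: SilvermanAEC2009, Prop. III.8.1(e)] -/
theorem muLocalPow_weilPairingHom (S T : geomTorsion W ((p ^ (k + 1) : ℕ) : ℤ)) :
    (muLocalPow v k).hom (weilPairingHom W (p ^ (k + 1)) (ePk (k + 1)) (hμPk (k + 1)) (hadd₁Pk (k + 1)) (hadd₂Pk (k + 1)) S T) =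
      weilPairingHom W (p ^ k) (ePk k) (hμPk k) (hadd₁Pk k) (hadd₂Pk k) ((torsionLocalPow W v k).hom S)
        ((torsionLocalPow W v k).hom T) := by
  apply muVal_injective ℚ (p ^ k)
  apply Units.ext
  rw [muVal_muLocalPow, Units.val_pow_eq_pow_val]
  change (((DiscreteGaloisModule.MuCarrier.toAdditive (weilPairingHom W (p ^ (k + 1)) (ePk (k + 1)) (hμPk (k + 1))
      (hadd₁Pk (k + 1)) (hadd₂Pk (k + 1)) S T)).toMul : (AlgebraicClosure ℚ)ˣ) : AlgebraicClosure ℚ) ^ p =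
    (((DiscreteGaloisModule.MuCarrier.toAdditive (weilPairingHom W (p ^ k) (ePk k) (hμPk k) (hadd₁Pk k) (hadd₂Pk k)
      ((torsionLocalPow W v k).hom S) ((torsionLocalPow W v k).hom T))).toMul : (AlgebraicClosure ℚ)ˣ) : AlgebraicClosure ℚ)
  rw [coe_weilPairingHom, coe_weilPairingHom]
  exact (hcompatPk k S T).symm

include hcompatPk in
omit [ContinuousSMul ℤ_[p] (W.tateModule p)] [W.IsElliptic] in
/-- **(5) The cup products of the summed Weil pairings are compatible along the level**:
`[p]_* a ∪_{Σe_k} [p]_* b = ((·)^p)_* (a ∪_{Σe_{k+1}} b)` (tree `ContPairing.cupProduct_coindFin_map`). [cite: SilvermanAEC2009, Prop. III.8.1(e)]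
[cite: NeukirchSchmidtWingberg2008, I §4 (1.4.2)] -/
theorem cupProduct_layerSumPairing_succ (n : ℕ)
    (a b : continuousCohomology 1 (coindFin.{0, 0} (torsionLocalRep W (p ^ (k + 1)) v) (layerGroup κ v n))) :
    cohomologyMap (muLocalPow v k) 2
        ((layerSumPairing W (p ^ (k + 1)) (ePk (k + 1)) (hμPk (k + 1)) (hadd₁Pk (k + 1)) (hadd₂Pk (k + 1)) (hgalPk (k + 1)) κ v n).cupProduct a b) =
      (layerSumPairing W (p ^ k) (ePk k) (hμPk k) (hadd₁Pk k) (hadd₂Pk k) (hgalPk k) κ v n).cupProduct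
        (cohomologyMap (coindFinMap (torsionLocalPow W v k) (layerGroup κ v n)) 1 a)
        (cohomologyMap (coindFinMap (torsionLocalPow W v k) (layerGroup κ v n)) 1 b) := by
  letI : Fintype (absoluteGaloisGroup (v.adicCompletion ℚ) ⧸ layerGroup κ v n) := layerFintypeQuot κ v n
  unfold layerSumPairing
  exact ContPairing.cupProduct_coindFin_map _ _ _ _ _ (layerGroup κ v n)
    (fun S T => muLocalPow_weilPairingHom W v k ePk hμPk hadd₁Pk hadd₂Pk hcompatPk S T) a b

/-- **(6) THE invariant maps are compatible along `(·)^p : μ_{p^{k+1}} → μ_{p^k}`**: `inv^{(p^k)}(((·)^p)_* C) = inv^{(p^{k+1})}(C) mod p^k`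
(the tree's `invLevel_muPowHom` for `ℚ_v`, transported along `μ(ℚ̄)| ≅ μ(ℚ̄_v)`). [cite: SerreLocalFields1979, XIII §3 (Prop. 6–7)] -/
theorem invAt_cohomologyMap_muLocalPow (C : continuousCohomology 2 (muLocalRep (p ^ (k + 1)) v)) :
    haveI : NeZero (p ^ k) := ⟨pow_ne_zero k (Fact.out : p.Prime).ne_zero⟩
    haveI : NeZero (p ^ (k + 1)) := ⟨pow_ne_zero (k + 1) (Fact.out : p.Prime).ne_zero⟩
    invAt (p ^ k) v (cohomologyMap (muLocalPow v k) 2 C) =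
      ZMod.castHom (Dvd.intro p (pow_mul_prime_eq k)) (ZMod (p ^ k)) (invAt (p ^ (k + 1)) v C) := by
  haveI : NeZero (p ^ k) := ⟨pow_ne_zero k (Fact.out : p.Prime).ne_zero⟩
  haveI : NeZero (p ^ (k + 1)) := ⟨pow_ne_zero (k + 1) (Fact.out : p.Prime).ne_zero⟩
  -- swap `μ(ℚ̄)| ≅ μ(ℚ̄_v)` and the power maps BEFORE `CharZero ℚ_v` is in context (2nd non-defeq `Algebra ℚ ℚ_v` path)
  have hpt : ∀ x : DiscreteGaloisModule.MuCarrier ℚ (p ^ (k + 1)),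
      (resIdHom (muLocalPow v k ≫ (muLocalIso v (p ^ k)).hom)).hom x =
        (resIdHom (muPowHom (v.adicCompletion ℚ) (p ^ (k + 1)) (p ^ k) p (pow_mul_prime_eq k))).hom
          ((resIdHom (muLocalIso v (p ^ (k + 1))).hom).hom x) := fun x => by
    apply muVal_injective (v.adicCompletion ℚ) (p ^ k)
    change muVal (v.adicCompletion ℚ) (p ^ k) (muTransfer ℚ (v.adicCompletion ℚ) (p ^ k)
        (muPow ℚ (p ^ (k + 1)) (p ^ k) p (pow_mul_prime_eq k) x)) =
      muVal (v.adicCompletion ℚ) (p ^ k) (muPow (v.adicCompletion ℚ) (p ^ (k + 1)) (p ^ k) p (pow_mul_prime_eq k)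
        (muTransfer ℚ (v.adicCompletion ℚ) (p ^ (k + 1)) x))
    rw [muVal_muPow, muVal_muTransfer, muVal_muTransfer, muVal_muPow, map_pow]
  have h1 := map_comp_apply_of (ContinuousMonoidHom.id _) (ContinuousMonoidHom.id _) (ContinuousMonoidHom.id _) (fun _ => rfl)
    (resIdHom (muLocalPow v k)) (resIdHom (muLocalIso v (p ^ k)).hom)
    (resIdHom (muLocalPow v k ≫ (muLocalIso v (p ^ k)).hom)) (fun _ => rfl) 2 C
  have h2 := map_comp_apply_of (ContinuousMonoidHom.id _) (ContinuousMonoidHom.id _) (ContinuousMonoidHom.id _) (fun _ => rfl)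
    (resIdHom (muLocalIso v (p ^ (k + 1))).hom)
    (resIdHom (muPowHom (v.adicCompletion ℚ) (p ^ (k + 1)) (p ^ k) p (pow_mul_prime_eq k)))
    (resIdHom (muLocalPow v k ≫ (muLocalIso v (p ^ k)).hom)) hpt 2 C
  have hswap : (cohomologyMap (muLocalIso v (p ^ k)).hom 2).hom (cohomologyMap (muLocalPow v k) 2 C) =
      cohomologyMap (muPowHom (v.adicCompletion ℚ) (p ^ (k + 1)) (p ^ k) p (pow_mul_prime_eq k)) 2
        ((cohomologyMap (muLocalIso v (p ^ (k + 1))).hom 2).hom C) :=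
    h1.symm.trans h2
  haveI : CharZero (v.adicCompletion ℚ) := charZero_adicCompletion v
  unfold invAt localInvariantMap
  change Prop121vii.invLevel (v.adicCompletion ℚ) (p ^ k)
      ((cohomologyMap (muLocalIso v (p ^ k)).hom 2).hom (cohomologyMap (muLocalPow v k) 2 C)) =
    ZMod.castHom (Dvd.intro p (pow_mul_prime_eq k)) (ZMod (p ^ k))
      (Prop121vii.invLevel (v.adicCompletion ℚ) (p ^ (k + 1)) ((cohomologyMap (muLocalIso v (p ^ (k + 1))).hom 2).hom C))
  rw [hswap]
  exact invLevel_muPowHom (v.adicCompletion ℚ) (pow_mul_prime_eq k) _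

include hcompatPk in
/-- **LEVEL COMPATIBILITY of the layer pairings**: `pk n (k+1) x Q mod p^k = pk n k x Q` — the hypothesis `hcompat` of
`exists_linear_layerPairing_of_compatible`, from a COMPATIBLE tower of Weil pairings (`hcompatPk`, Silverman III.8.1(e) — the
tree's `exists_weilPairing_tower`): (1) reductions, (2) localisation, (3) Shapiro (`shapiroLift_cohomologyMap`), (4) Kummer,
(5) summed Weil cup products, (6) invariant maps are all compatible with `[p]` / `(·)^p`.
[cite: SilvermanAEC2009, Prop. III.8.1(e)] [cite: Kato2004Asterisque, §13.8 (pp. 228–229)] [cite: PerrinRiou1994Invent, §3.6.1] -/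
theorem layerPairingPk_succ_compat (n : ℕ) (x : H1 (tateRep W p) (κ.layerSubgroup n))
    (Q : localLayerPointsOfEmb κ (closureEmb (K := ℚ) (v.adicCompletion ℚ)) W n) :
    (ZMod.cast (layerPairingPk W κ v ePk hμPk hadd₁Pk hadd₂Pk hgalPk n (k + 1) x Q) : ZMod (p ^ k)) =
      layerPairingPk W κ v ePk hμPk hadd₁Pk hadd₂Pk hgalPk n k x Q := by
  haveI : NeZero (p ^ k) := ⟨pow_ne_zero k (Fact.out : p.Prime).ne_zero⟩
  haveI : NeZero (p ^ (k + 1)) := ⟨pow_ne_zero (k + 1) (Fact.out : p.Prime).ne_zero⟩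
  have hcast : ∀ z : ZMod (p ^ (k + 1)), (ZMod.cast z : ZMod (p ^ k)) = ZMod.castHom (Dvd.intro p (pow_mul_prime_eq k)) (ZMod (p ^ k)) z :=
    fun z => rfl
  rw [hcast, layerPairingPk_apply, layerPairingPk_apply, layerPairingMod_apply, layerPairingMod_apply,
    ← invAt_cohomologyMap_muLocalPow v k, cupProduct_layerSumPairing_succ W κ v k ePk hμPk hadd₁Pk hadd₂Pk hgalPk hcompatPk n]
  unfold layerShapiro
  rw [← shapiroLift_cohomologyMap, ← shapiroLift_cohomologyMap, ← layerLoc_cohomologyMap_torsionPow,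
    cohomologyMap_torsionPow_reduceH1Pk, cohomologyMap_torsionLocalPow_layerKummer]

end Compat

/-! ## §5 The unconditional `∃ pair` for the cyclotomic tower at `v ∣ p` -/

section Unconditional

open Literature.NumberTheory.EllipticCurves.Kato2004 Literature.NumberTheory.EllipticCurves.Kato2004.EulerSystemValues

omit [W.IsElliptic] in
/-- `p^k ≠ 0` in `ℚ` (the level hypothesis of `weilPairingFun`). [cite: SilvermanAEC2009, Prop. III.8.1] -/
theorem natCast_pow_prime_ne_zero (k : ℕ) : ((p ^ k : ℕ) : ℚ) ≠ 0 := by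
  exact_mod_cast pow_ne_zero k (Fact.out : p.Prime).ne_zero

omit [W.IsElliptic] [Fact p.Prime] in
/-- A `p^k`-torsion point is killed by `p^k` (`ℕ`-cast index). [cite: SilvermanAEC2009, Prop. III.8.1] -/
theorem zsmul_coe_geomTorsion_pow (k : ℕ) (S : geomTorsion W ((p ^ k : ℕ) : ℤ)) :
    ((p ^ k : ℕ) : ℤ) • (S : geomPoints W) = 0 :=
  (mem_geomTorsion_iff W _ _).mp S.2

/-- **THE Weil pairings of the tree on the `p`-power torsion**: `e_{p^k} := weilPairingFun` at level `m = p^k`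
(`WeierstrassCurve.weilPairingFun`, Silverman III §8), as the family `ePk` the layer pairings `layerPairingPk` take.
[cite: SilvermanAEC2009, Prop. III.8.1 (a)–(e)] -/
def weilTowerPk : ∀ k : ℕ, geomTorsion W (p ^ k) → geomTorsion W (p ^ k) → AlgebraicClosure ℚ :=
  fun k S T => weilPairingFun (natCast_pow_prime_ne_zero (p := p) k) (S : geomPoints W) (T : geomPoints W)

/-- Unfolding `weilTowerPk`. [cite: SilvermanAEC2009, Prop. III.8.1] -/
theorem weilTowerPk_apply (k : ℕ) (S T : geomTorsion W (p ^ k)) :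
    weilTowerPk W k S T = weilPairingFun (natCast_pow_prime_ne_zero (p := p) k) (S : geomPoints W) (T : geomPoints W) := rfl

/-- `e_{p^k}(S,T)^{p^k} = 1` (`weilPairingFun_pow`). [cite: SilvermanAEC2009, Prop. III.8.1] -/
theorem weilTowerPk_pow (k : ℕ) (S T : geomTorsion W (p ^ k)) : weilTowerPk W k S T ^ (p ^ k) = 1 :=
  weilPairingFun_pow (natCast_pow_prime_ne_zero (p := p) k) (zsmul_coe_geomTorsion_pow W k S) (zsmul_coe_geomTorsion_pow W k T)

/-- `e_{p^k}` is additive in `S` (`weilPairingFun_add_left`). [cite: SilvermanAEC2009, Prop. III.8.1 (a)] -/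
theorem weilTowerPk_add_left (k : ℕ) (S₁ S₂ T : geomTorsion W (p ^ k)) :
    weilTowerPk W k (S₁ + S₂) T = weilTowerPk W k S₁ T * weilTowerPk W k S₂ T :=
  weilPairingFun_add_left (natCast_pow_prime_ne_zero (p := p) k) (zsmul_coe_geomTorsion_pow W k S₁) (zsmul_coe_geomTorsion_pow W k S₂)
    (zsmul_coe_geomTorsion_pow W k T)

/-- `e_{p^k}` is additive in `T` (`weilPairingFun_add_right`). [cite: SilvermanAEC2009, Prop. III.8.1 (a)] -/
theorem weilTowerPk_add_right (k : ℕ) (S T₁ T₂ : geomTorsion W (p ^ k)) :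
    weilTowerPk W k S (T₁ + T₂) = weilTowerPk W k S T₁ * weilTowerPk W k S T₂ :=
  weilPairingFun_add_right (natCast_pow_prime_ne_zero (p := p) k) (zsmul_coe_geomTorsion_pow W k S) (zsmul_coe_geomTorsion_pow W k T₁)
    (zsmul_coe_geomTorsion_pow W k T₂)

/-- `e_{p^k}` is `Γ_ℚ`-equivariant (`weilPairingFun_smul`). [cite: SilvermanAEC2009, Prop. III.8.1 (d)] -/
theorem weilTowerPk_smul (k : ℕ) (σ : absoluteGaloisGroup ℚ) (S T : geomTorsion W (p ^ k)) :
    σ • weilTowerPk W k S T = weilTowerPk W k (σ • S) (σ • T) := by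
  rw [weilTowerPk_apply, weilTowerPk_apply, Literature.NumberTheory.EllipticCurves.AddSubgroup.torsionBy.coe_smul,
    Literature.NumberTheory.EllipticCurves.AddSubgroup.torsionBy.coe_smul,
    weilPairingFun_smul (natCast_pow_prime_ne_zero (p := p) k) σ (zsmul_coe_geomTorsion_pow W k S) (zsmul_coe_geomTorsion_pow W k T)]

/-- **The tower is compatible along `[p]`**: `e_{p^k}(pS, pT) = e_{p^{k+1}}(S,T)^p` (`weilPairingFun_pow_succ`,
Silverman III.8.1 (e)). [cite: SilvermanAEC2009, Prop. III.8.1 (e)] -/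
theorem weilTowerPk_torsionPow (k : ℕ) (S T : geomTorsion W ((p ^ (k + 1) : ℕ) : ℤ)) :
    weilTowerPk W k ((torsionPow W k).hom S) ((torsionPow W k).hom T) = weilTowerPk W (k + 1) S T ^ p :=
  weilPairingFun_pow_succ k (natCast_pow_prime_ne_zero (p := p) k) (natCast_pow_prime_ne_zero (p := p) (k + 1)) (zsmul_coe_geomTorsion_pow W (k + 1) S) (zsmul_coe_geomTorsion_pow W (k + 1) T)

variable [ContinuousSMul ℤ_[p] (W.tateModule p)] (hκ : κ.IsCyclotomic) (hv : (p : 𝓞 ℚ) ∈ v.asIdeal)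

include hκ hv in
/-- **(D-layer), unconditionally: `ℤ_p`-linear layer pairings `pair n : H¹(ℚ_n, T_pW) →ₗ[ℤ_p] Hom(E(ℚ_{n,v}), ℤ_p)` whose
residues modulo every `p^k` are THE finite local Tate pairings `layerPairingPk` built from THE Weil pairings `weilTowerPk`
(`toZModPow k (pair n x Q) = inv_v(Sh loc red_k x ∪_{e_{p^k}} Sh κ_k Q)`), with the projection formula (P1) and the
Galois invariance (P2)** for the cyclotomic `ℤ_p`-tower of `ℚ` at `v ∣ p` — the (pair, P1, P2) data of the research stub
`Cruxes.SignedKatoDivisibilityUpToAtTwo.ColemanRat.stub_layerSideTwoInv`, i.e. the hypotheses of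
`SignedKatoOffTwo.ColGlue.exists_col_linear` (for every local `g`). Proof: `exists_linear_layerPairing_of_compatible` with the
level compatibility `layerPairingPk_succ_compat` discharged by Silverman III.8.1 (e) (`weilTowerPk_torsionPow`).
[cite: Kobayashi2003, (8.23) (p. 18)] [cite: PerrinRiou1994Invent, §3.6.1] [cite: Kato2004Asterisque, §13.8 (pp. 228–229)]
[cite: SilvermanAEC2009, Prop. III.8.1] -/
theorem exists_linear_layerPairing :
    ∃ pair : ∀ n : ℕ, H1 (tateRep W p) (κ.layerSubgroup n) →ₗ[ℤ_[p]]
        (localLayerPointsOfEmb κ (closureEmb (K := ℚ) (v.adicCompletion ℚ)) W n →+ ℤ_[p]),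
      (∀ (n k : ℕ) (x : H1 (tateRep W p) (κ.layerSubgroup n))
          (Q : localLayerPointsOfEmb κ (closureEmb (K := ℚ) (v.adicCompletion ℚ)) W n),
          PadicInt.toZModPow k (pair n x Q) =
            layerPairingPk W κ v (weilTowerPk W) (weilTowerPk_pow W) (weilTowerPk_add_left W) (weilTowerPk_add_right W)
              (weilTowerPk_smul W) n k x Q) ∧
      (∀ (n : ℕ) (x : H1 (tateRep W p) (κ.layerSubgroup (n + 1))) (Q : localPoints W (v.adicCompletion ℚ))
          (hQ : Q ∈ localLayerPointsOfEmb κ (closureEmb (K := ℚ) (v.adicCompletion ℚ)) W n),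
          pair n (layerCores (tateRep W p) κ n x) ⟨Q, hQ⟩ =
            pair (n + 1) x ⟨Q, localLayerPointsOfEmb_mono κ (closureEmb (K := ℚ) (v.adicCompletion ℚ)) W
              (Nat.le_succ n) hQ⟩) ∧
      (∀ (n : ℕ) (g : absoluteGaloisGroup (v.adicCompletion ℚ)) (y : H1 (tateRep W p) (κ.layerSubgroup n))
          (Q : localPoints W (v.adicCompletion ℚ))
          (hQ : Q ∈ localLayerPointsOfEmb κ (closureEmb (K := ℚ) (v.adicCompletion ℚ)) W n),
          pair n (conjMap (tateRep W p).toTopRep (κ.layerSubgroup n)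
              (resGalOfEmb (closureEmb (K := ℚ) (v.adicCompletion ℚ)) g) 1 y)
            ⟨g • Q, smul_mem_localLayerPointsOfEmb κ (closureEmb (K := ℚ) (v.adicCompletion ℚ)) W n g hQ⟩ =
          pair n y ⟨Q, hQ⟩) :=
  exists_linear_layerPairing_of_compatible W κ v (weilTowerPk W) (weilTowerPk_pow W) (weilTowerPk_add_left W)
    (weilTowerPk_add_right W) (weilTowerPk_smul W) hκ hv
    (fun n k x Q => layerPairingPk_succ_compat W κ v k (weilTowerPk W) _ _ _ _ (weilTowerPk_torsionPow W) n x Q)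

end Unconditional

end SignedKatoOffTwo.LayerPairing

end Summit.BirchSwinnertonDyer.BirchSwinnertonDyer.Theorems

end
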